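import Mathlib
import Literature.MeasureTheory.Integral.HPolyhedronFacetChart
import HarnessLib

/-!
# Gauss–Green, vertical component, for an H-polyhedron — in FACET-CHART form (brick T1(i))

Topic `Literature/MeasureTheory/Integral`; namespace `Literature.MeasureTheory.Integral`.
Continuation of `HPolyhedronTopFacets` (L3: the vertical Gauss–Green integral over
`P = {(x,t) | ∀ j ∈ J, α_j x₁ + β_j x₂ + c_j t ≤ b_j}` as a signed sum of GRAPH integrals over the
least-active pieces `D_j^±`) and `HPolyhedronFacetChart` (L4: graph integral over a planar piece
`= |c_j|/‖n_j‖ ×` integral over an isometric chart `φ_j` of the facet plane).  Here the two are combined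
and the least-active pieces are identified with the facets up to null sets:
`∫_P ∂_t g = Σ_{j ∈ J, c_j ≠ 0} (c_j/‖n_j‖) · ∫_{y ∈ ℝ²} 1_P(φ_j y) · g(φ_j y) dy`
(`setIntegral_deriv_hPolyhedron_eq_sum_chart`), under the non-degeneracy hypothesis that distinct
non-vertical constraints define distinct planes (then the tie sets `{aff_j = aff_k}` are lines, hence
null: `volume_affineLine_eq_zero`).  The integrand `1_P(φ_j y) g(φ_j y)` is the restriction of `g` to the
`j`-th FACET `P ∩ Π_j` read in the chart; with `‖n_j‖ = 1` the weight is `c_j = ⟪a_j, e_t⟫`, so summing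
the three coordinate directions gives `∫_P div η = Σ_j ∫_{F_j} ⟪η, a_j⟫ dσ` (brick T1, not here).
Integrability side conditions are carried as hypotheses exactly as in L3.
-/

noncomputable section

namespace Literature.MeasureTheory.Integral

open _root_.MeasureTheory Set Finset

variable {ι : Type*} [LinearOrder ι]

/-! ### Lines are null in `ℝ × ℝ` -/

/-- An affine line `{x | e₁x₁ + e₂x₂ = d}` (`(e₁, e₂) ≠ 0`) has planar Lebesgue measure zero.
[cite: EvansGariepy2015, Thm 5.16 (Gauss–Green), polyhedral case — plumbing] -/
theorem volume_affineLine_eq_zero {e₁ e₂ d : ℝ} (he : e₁ ≠ 0 ∨ e₂ ≠ 0) :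
    volume {x : ℝ × ℝ | e₁ * x.1 + e₂ * x.2 = d} = 0 := by
  have hmeas : MeasurableSet {x : ℝ × ℝ | e₁ * x.1 + e₂ * x.2 = d} :=
    measurableSet_eq_fun (by fun_prop) measurable_const
  rcases eq_or_ne e₂ 0 with h2 | h2
  · have h1 : e₁ ≠ 0 := he.resolve_right (not_not.2 h2)
    have hset : {x : ℝ × ℝ | e₁ * x.1 + e₂ * x.2 = d} = ({d / e₁} : Set ℝ) ×ˢ (univ : Set ℝ) := by
      ext x
      simp only [Set.mem_setOf_eq, Set.mem_prod, Set.mem_singleton_iff, Set.mem_univ, and_true, h2,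
        zero_mul, add_zero]
      rw [eq_div_iff h1, mul_comm]
    rw [hset, Measure.volume_eq_prod, Measure.prod_prod, Real.volume_singleton, zero_mul]
  · rw [Measure.volume_eq_prod, Measure.prod_apply hmeas]
    have hfib : ∀ a : ℝ, volume (Prod.mk a ⁻¹' {x : ℝ × ℝ | e₁ * x.1 + e₂ * x.2 = d}) = 0 := by
      intro a
      have : Prod.mk a ⁻¹' {x : ℝ × ℝ | e₁ * x.1 + e₂ * x.2 = d} = {(d - e₁ * a) / e₂} := by
        ext y
        simp only [Set.mem_preimage, Set.mem_setOf_eq, Set.mem_singleton_iff]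
        rw [eq_div_iff h2]
        constructor
        · intro h; linarith
        · intro h; linarith
      rw [this, Real.volume_singleton]
    simp_rw [hfib]
    simp

/-- Tie sets of two DISTINCT affine graphs `x ↦ (b − αx₁ − βx₂)/c`, `x ↦ (b' − α'x₁ − β'x₂)/c'` are null.
[cite: EvansGariepy2015, Thm 5.16 (Gauss–Green), polyhedral case — plumbing] -/
theorem volume_tieSet_eq_zero {α β c b α' β' c' b' : ℝ} (hc : c ≠ 0) (hc' : c' ≠ 0)
    (hne : ∃ x : ℝ × ℝ, (b - α * x.1 - β * x.2) / c ≠ (b' - α' * x.1 - β' * x.2) / c') :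
    volume {x : ℝ × ℝ | (b - α * x.1 - β * x.2) / c = (b' - α' * x.1 - β' * x.2) / c'} = 0 := by
  -- `aff x − aff' x = −(e₁ x₁ + e₂ x₂) + e₀`, `e₁ = α/c − α'/c'`, `e₂ = β/c − β'/c'`, `e₀ = b/c − b'/c'`
  have key : ∀ x : ℝ × ℝ, (b - α * x.1 - β * x.2) / c - (b' - α' * x.1 - β' * x.2) / c' =
      -((α / c - α' / c') * x.1 + (β / c - β' / c') * x.2) + (b / c - b' / c') := by
    intro x; field_simp; ring
  have hset : {x : ℝ × ℝ | (b - α * x.1 - β * x.2) / c = (b' - α' * x.1 - β' * x.2) / c'} =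
      {x : ℝ × ℝ | (α / c - α' / c') * x.1 + (β / c - β' / c') * x.2 = b / c - b' / c'} := by
    ext x
    simp only [Set.mem_setOf_eq]
    constructor
    · intro h; linarith [key x]
    · intro h; linarith [key x]
  rw [hset]
  by_cases h1 : α / c - α' / c' = 0
  · by_cases h2 : β / c - β' / c' = 0
    · -- parallel case: the graphs differ by the constant `e₀ ≠ 0`, the tie set is empty
      obtain ⟨x₀, hx₀⟩ := hne
      have he₀ : b / c - b' / c' ≠ 0 := by
        intro h0
        apply hx₀
        have := key x₀
        rw [h1, h2, h0] at this
        linarith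
      have hempty : {x : ℝ × ℝ | (α / c - α' / c') * x.1 + (β / c - β' / c') * x.2 = b / c - b' / c'}
          = ∅ := by
        ext x
        simp only [Set.mem_setOf_eq, Set.mem_empty_iff_false, iff_false, h1, h2, zero_mul, add_zero]
        exact fun h => he₀ h.symm
      rw [hempty, measure_empty]
    · exact volume_affineLine_eq_zero (Or.inr h2)
  · exact volume_affineLine_eq_zero (Or.inl h1)

/-! ### One upper piece = `c_j/‖n_j‖ ×` the facet-chart integral -/

/-- **Upper piece ↔ facet chart.**  For an upper constraint `j` (`c_j > 0`) of the H-polyhedron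
`P = {∀ k ∈ J, α_k x₁ + β_k x₂ + c_k t ≤ b_k}` whose plane differs from the other upper planes, and an
isometric chart `φ_j y = p₀ + y₁u + y₂v` of its plane: the graph integral over the least-active piece
`D_j⁺` equals `(c_j/‖n_j‖) ∫ 1_P(φ_j y) g(φ_j y) dy`.
[cite: EvansGariepy2015, Thm 5.16 (Gauss–Green), polyhedral case — upper facets] -/
theorem setIntegral_upperPiece_eq_chart {J : Finset ι} (α β c b : ι → ℝ)
    (hup : (J.filter fun j => 0 < c j).Nonempty) (hlow : (J.filter fun j => c j < 0).Nonempty)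
    {j : ι} (hjJ : j ∈ J) (hcj : 0 < c j)
    (hnd : ∀ k ∈ J, k ≠ j → 0 < c k →
      ∃ x : ℝ × ℝ, (b j - α j * x.1 - β j * x.2) / c j ≠ (b k - α k * x.1 - β k * x.2) / c k)
    (p₀ u v : (ℝ × ℝ) × ℝ) (hp₀ : α j * p₀.1.1 + β j * p₀.1.2 + c j * p₀.2 = b j)
    (hnu : α j * u.1.1 + β j * u.1.2 + c j * u.2 = 0) (hnv : α j * v.1.1 + β j * v.1.2 + c j * v.2 = 0)
    (hu : u.1.1 ^ 2 + u.1.2 ^ 2 + u.2 ^ 2 = 1) (hv : v.1.1 ^ 2 + v.1.2 ^ 2 + v.2 ^ 2 = 1)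
    (huv : u.1.1 * v.1.1 + u.1.2 * v.1.2 + u.2 * v.2 = 0) (g : (ℝ × ℝ) × ℝ → ℝ) :
    ∫ x in {x : ℝ × ℝ | x ∈ {x : ℝ × ℝ | (∀ k ∈ J, c k = 0 → α k * x.1 + β k * x.2 ≤ b k) ∧
            (J.filter fun k => c k < 0).sup' hlow (fun k => (b k - (α k * x.1 + β k * x.2)) / c k) ≤
              (J.filter fun k => 0 < c k).inf' hup (fun k => (b k - (α k * x.1 + β k * x.2)) / c k)} ∧
          (b j - (α j * x.1 + β j * x.2)) / c j =
            (J.filter fun k => 0 < c k).inf' hup (fun k => (b k - (α k * x.1 + β k * x.2)) / c k) ∧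
          ∀ k ∈ J.filter (fun k => 0 < c k), k < j →
            (J.filter fun k => 0 < c k).inf' hup (fun k => (b k - (α k * x.1 + β k * x.2)) / c k) <
              (b k - (α k * x.1 + β k * x.2)) / c k},
        g (x, (b j - (α j * x.1 + β j * x.2)) / c j) =
      c j / Real.sqrt (α j ^ 2 + β j ^ 2 + c j ^ 2) *
        ∫ y : ℝ × ℝ, {p : (ℝ × ℝ) × ℝ | ∀ k ∈ J, α k * p.1.1 + β k * p.1.2 + c k * p.2 ≤ b k}.indicator
          (fun _ => (1 : ℝ)) (p₀ + y.1 • u + y.2 • v) * g (p₀ + y.1 • u + y.2 • v) := by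
  classical
  set U := J.filter (fun k => 0 < c k) with hU
  set hi : ℝ × ℝ → ℝ := fun x => U.inf' hup (fun k => (b k - (α k * x.1 + β k * x.2)) / c k) with hhi
  set lo : ℝ × ℝ → ℝ :=
    fun x => (J.filter fun k => c k < 0).sup' hlow (fun k => (b k - (α k * x.1 + β k * x.2)) / c k)
    with hlo
  set D : Set (ℝ × ℝ) := {x | (∀ k ∈ J, c k = 0 → α k * x.1 + β k * x.2 ≤ b k) ∧ lo x ≤ hi x} with hD
  set aff : ι → ℝ × ℝ → ℝ := fun k x => (b k - (α k * x.1 + β k * x.2)) / c k with haff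
  set P : Set ((ℝ × ℝ) × ℝ) := {p | ∀ k ∈ J, α k * p.1.1 + β k * p.1.2 + c k * p.2 ≤ b k} with hP
  set Dj : Set (ℝ × ℝ) := {x | x ∈ D ∧ aff j x = hi x ∧ ∀ k ∈ U, k < j → hi x < aff k x} with hDj
  set Sj : Set (ℝ × ℝ) := {x | x ∈ D ∧ aff j x = hi x} with hSj
  have hA : ∀ k, Continuous (fun x : ℝ × ℝ => α k * x.1 + β k * x.2) := fun k => by fun_prop
  have hjU : j ∈ U := Finset.mem_filter.2 ⟨hjJ, hcj⟩
  -- measurability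
  have hDm : MeasurableSet D :=
    measurableSet_baseOfHConstraints (A := fun k (x : ℝ × ℝ) => α k * x.1 + β k * x.2) hA c b hup hlow
  have hhim : Measurable hi :=
    (continuous_hiGraph (A := fun k (x : ℝ × ℝ) => α k * x.1 + β k * x.2) hA c b hup).measurable
  have haffm : ∀ k, Measurable (aff k) := fun k =>
    ((continuous_const.sub (hA k)).div_const _).measurable
  have hSjm : MeasurableSet Sj := hDm.inter (measurableSet_eq_fun (haffm j) hhim)
  -- (i) the least-active piece is a.e. the whole active set
  have hsub1 : Dj ⊆ Sj := fun x hx => ⟨hx.1, hx.2.1⟩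
  have hnull : volume (Sj \ Dj) = 0 := by
    have hcover : Sj \ Dj ⊆ ⋃ k ∈ U.filter (fun k => k < j),
        {x : ℝ × ℝ | (b j - α j * x.1 - β j * x.2) / c j = (b k - α k * x.1 - β k * x.2) / c k} := by
      intro x hx
      obtain ⟨⟨hxD, hxj⟩, hxn⟩ := hx
      have : ¬ ∀ k ∈ U, k < j → hi x < aff k x := fun h => hxn ⟨hxD, hxj, h⟩
      push Not at this
      obtain ⟨k, hkU, hkj, hk⟩ := this
      have hle : hi x ≤ aff k x := Finset.inf'_le _ hkU
      have hEq : aff j x = aff k x := by rw [hxj]; exact le_antisymm hle hk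
      refine Set.mem_biUnion (Finset.mem_filter.2 ⟨hkU, hkj⟩) ?_
      simp only [Set.mem_setOf_eq]
      have e1 : (b j - α j * x.1 - β j * x.2) / c j = aff j x := by rw [haff]; ring_nf
      have e2 : (b k - α k * x.1 - β k * x.2) / c k = aff k x := by rw [haff]; ring_nf
      rw [e1, e2]; exact hEq
    refine measure_mono_null hcover ?_
    refine (measure_biUnion_null_iff (U.filter (fun k => k < j)).countable_toSet).2 fun k hk => ?_
    have hk' := Finset.mem_filter.1 hk
    have hkU := Finset.mem_filter.1 hk'.1
    exact volume_tieSet_eq_zero hcj.ne' hkU.2.ne' (hnd k hkU.1 (ne_of_lt hk'.2) hkU.2)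
  have hae : Dj =ᵐ[volume] Sj := by
    refine (ae_eq_set).2 ⟨?_, hnull⟩
    exact measure_mono_null (fun x hx => (hx.2 (hsub1 hx.1)).elim) measure_empty
  -- (ii) graph integral over `Sj` by the facet chart
  have hL4 := setIntegral_graph_eq_mul_integral_chart (α := α j) (β := β j) (c := c j) (b := b j)
    hcj.ne' p₀ u v hp₀ hnu hnv hu hv huv hSjm g
  -- (iii) on the chart, `1_{Sj} ∘ π = 1_P`
  have hPeq := setOf_hConstraints_eq_between_graphs (J := J)
    (fun k (x : ℝ × ℝ) => α k * x.1 + β k * x.2) c b hup hlow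
  have hplane : ∀ y : ℝ × ℝ, (p₀ + y.1 • u + y.2 • v).2 = aff j (p₀ + y.1 • u + y.2 • v).1 := by
    intro y
    simp only [haff, Prod.fst_add, Prod.snd_add, Prod.smul_fst, Prod.smul_snd, smul_eq_mul]
    rw [eq_div_iff hcj.ne']
    linear_combination hp₀ + y.1 * hnu + y.2 * hnv
  have hind : ∀ y : ℝ × ℝ, Sj.indicator (fun _ => (1 : ℝ)) (p₀ + y.1 • u + y.2 • v).1 =
      P.indicator (fun _ => (1 : ℝ)) (p₀ + y.1 • u + y.2 • v) := by
    intro y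
    have hiff : (p₀ + y.1 • u + y.2 • v).1 ∈ Sj ↔ (p₀ + y.1 • u + y.2 • v) ∈ P := by
      have hmemP : (p₀ + y.1 • u + y.2 • v) ∈ P ↔ (p₀ + y.1 • u + y.2 • v).1 ∈ D ∧
          lo (p₀ + y.1 • u + y.2 • v).1 ≤ (p₀ + y.1 • u + y.2 • v).2 ∧
          (p₀ + y.1 • u + y.2 • v).2 ≤ hi (p₀ + y.1 • u + y.2 • v).1 := by
        rw [hP]
        change (p₀ + y.1 • u + y.2 • v) ∈
          {p : (ℝ × ℝ) × ℝ | ∀ k ∈ J, (fun k (x : ℝ × ℝ) => α k * x.1 + β k * x.2) k p.1 + c k * p.2 ≤ b k}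
          ↔ _
        rw [hPeq]
        rfl
      rw [hmemP, hplane]
      set x := (p₀ + y.1 • u + y.2 • v).1
      have hge : hi x ≤ aff j x := Finset.inf'_le _ hjU
      constructor
      · rintro ⟨hxD, hxj⟩
        exact ⟨hxD, by rw [hxj]; exact hxD.2, le_of_eq hxj⟩
      · rintro ⟨hxD, -, hle⟩
        exact ⟨hxD, le_antisymm hle hge⟩
    by_cases hm : (p₀ + y.1 • u + y.2 • v).1 ∈ Sj
    · rw [Set.indicator_of_mem hm, Set.indicator_of_mem (hiff.1 hm)]
    · rw [Set.indicator_of_notMem hm, Set.indicator_of_notMem (fun h => hm (hiff.2 h))]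
  -- assemble
  have e0 : (fun x : ℝ × ℝ => g (x, (b j - (α j * x.1 + β j * x.2)) / c j)) =
      fun x => g (x, (b j - α j * x.1 - β j * x.2) / c j) := by
    funext x; ring_nf
  calc ∫ x in Dj, g (x, (b j - (α j * x.1 + β j * x.2)) / c j)
      = ∫ x in Sj, g (x, (b j - (α j * x.1 + β j * x.2)) / c j) := setIntegral_congr_set hae
    _ = ∫ x in Sj, g (x, (b j - α j * x.1 - β j * x.2) / c j) := by rw [e0]
    _ = |c j| / Real.sqrt (α j ^ 2 + β j ^ 2 + c j ^ 2) *
          ∫ y : ℝ × ℝ, Sj.indicator (fun _ => (1 : ℝ)) (p₀ + y.1 • u + y.2 • v).1 *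
            g (p₀ + y.1 • u + y.2 • v) := hL4
    _ = c j / Real.sqrt (α j ^ 2 + β j ^ 2 + c j ^ 2) *
          ∫ y : ℝ × ℝ, P.indicator (fun _ => (1 : ℝ)) (p₀ + y.1 • u + y.2 • v) *
            g (p₀ + y.1 • u + y.2 • v) := by
        rw [abs_of_pos hcj]
        congr 1
        refine integral_congr_ae (Filter.Eventually.of_forall fun y => ?_)
        beta_reduce
        rw [hind y]

/-! ### One lower piece -/

/-- **Lower piece ↔ facet chart.**  For a lower constraint `j` (`c_j < 0`) whose plane differs from the
other lower planes: the graph integral over the least-active lower piece `D_j⁻` equals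
`(−c_j/‖n_j‖) ∫ 1_P(φ_j y) g(φ_j y) dy` (so that `−` the piece carries the weight `c_j/‖n_j‖`).
[cite: EvansGariepy2015, Thm 5.16 (Gauss–Green), polyhedral case — lower facets] -/
theorem setIntegral_lowerPiece_eq_chart {J : Finset ι} (α β c b : ι → ℝ)
    (hup : (J.filter fun j => 0 < c j).Nonempty) (hlow : (J.filter fun j => c j < 0).Nonempty)
    {j : ι} (hjJ : j ∈ J) (hcj : c j < 0)
    (hnd : ∀ k ∈ J, k ≠ j → c k < 0 →
      ∃ x : ℝ × ℝ, (b j - α j * x.1 - β j * x.2) / c j ≠ (b k - α k * x.1 - β k * x.2) / c k)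
    (p₀ u v : (ℝ × ℝ) × ℝ) (hp₀ : α j * p₀.1.1 + β j * p₀.1.2 + c j * p₀.2 = b j)
    (hnu : α j * u.1.1 + β j * u.1.2 + c j * u.2 = 0) (hnv : α j * v.1.1 + β j * v.1.2 + c j * v.2 = 0)
    (hu : u.1.1 ^ 2 + u.1.2 ^ 2 + u.2 ^ 2 = 1) (hv : v.1.1 ^ 2 + v.1.2 ^ 2 + v.2 ^ 2 = 1)
    (huv : u.1.1 * v.1.1 + u.1.2 * v.1.2 + u.2 * v.2 = 0) (g : (ℝ × ℝ) × ℝ → ℝ) :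
    ∫ x in {x : ℝ × ℝ | x ∈ {x : ℝ × ℝ | (∀ k ∈ J, c k = 0 → α k * x.1 + β k * x.2 ≤ b k) ∧
            (J.filter fun k => c k < 0).sup' hlow (fun k => (b k - (α k * x.1 + β k * x.2)) / c k) ≤
              (J.filter fun k => 0 < c k).inf' hup (fun k => (b k - (α k * x.1 + β k * x.2)) / c k)} ∧
          (b j - (α j * x.1 + β j * x.2)) / c j =
            (J.filter fun k => c k < 0).sup' hlow (fun k => (b k - (α k * x.1 + β k * x.2)) / c k) ∧
          ∀ k ∈ J.filter (fun k => c k < 0), k < j →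
            (b k - (α k * x.1 + β k * x.2)) / c k <
              (J.filter fun k => c k < 0).sup' hlow (fun k => (b k - (α k * x.1 + β k * x.2)) / c k)},
        g (x, (b j - (α j * x.1 + β j * x.2)) / c j) =
      -c j / Real.sqrt (α j ^ 2 + β j ^ 2 + c j ^ 2) *
        ∫ y : ℝ × ℝ, {p : (ℝ × ℝ) × ℝ | ∀ k ∈ J, α k * p.1.1 + β k * p.1.2 + c k * p.2 ≤ b k}.indicator
          (fun _ => (1 : ℝ)) (p₀ + y.1 • u + y.2 • v) * g (p₀ + y.1 • u + y.2 • v) := by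
  classical
  set U := J.filter (fun k => 0 < c k) with hU
  set Lo := J.filter (fun k => c k < 0) with hLo
  set hi : ℝ × ℝ → ℝ := fun x => U.inf' hup (fun k => (b k - (α k * x.1 + β k * x.2)) / c k) with hhi
  set lo : ℝ × ℝ → ℝ := fun x => Lo.sup' hlow (fun k => (b k - (α k * x.1 + β k * x.2)) / c k) with hlo
  set D : Set (ℝ × ℝ) := {x | (∀ k ∈ J, c k = 0 → α k * x.1 + β k * x.2 ≤ b k) ∧ lo x ≤ hi x} with hD
  set aff : ι → ℝ × ℝ → ℝ := fun k x => (b k - (α k * x.1 + β k * x.2)) / c k with haff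
  set P : Set ((ℝ × ℝ) × ℝ) := {p | ∀ k ∈ J, α k * p.1.1 + β k * p.1.2 + c k * p.2 ≤ b k} with hP
  set Dj : Set (ℝ × ℝ) := {x | x ∈ D ∧ aff j x = lo x ∧ ∀ k ∈ Lo, k < j → aff k x < lo x} with hDj
  set Sj : Set (ℝ × ℝ) := {x | x ∈ D ∧ aff j x = lo x} with hSj
  have hA : ∀ k, Continuous (fun x : ℝ × ℝ => α k * x.1 + β k * x.2) := fun k => by fun_prop
  have hjLo : j ∈ Lo := Finset.mem_filter.2 ⟨hjJ, hcj⟩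
  -- measurability
  have hDm : MeasurableSet D :=
    measurableSet_baseOfHConstraints (A := fun k (x : ℝ × ℝ) => α k * x.1 + β k * x.2) hA c b hup hlow
  have hlom : Measurable lo :=
    (continuous_loGraph (A := fun k (x : ℝ × ℝ) => α k * x.1 + β k * x.2) hA c b hlow).measurable
  have haffm : ∀ k, Measurable (aff k) := fun k =>
    ((continuous_const.sub (hA k)).div_const _).measurable
  have hSjm : MeasurableSet Sj := hDm.inter (measurableSet_eq_fun (haffm j) hlom)
  -- (i) the least-active piece is a.e. the whole active set
  have hsub1 : Dj ⊆ Sj := fun x hx => ⟨hx.1, hx.2.1⟩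
  have hnull : volume (Sj \ Dj) = 0 := by
    have hcover : Sj \ Dj ⊆ ⋃ k ∈ Lo.filter (fun k => k < j),
        {x : ℝ × ℝ | (b j - α j * x.1 - β j * x.2) / c j = (b k - α k * x.1 - β k * x.2) / c k} := by
      intro x hx
      obtain ⟨⟨hxD, hxj⟩, hxn⟩ := hx
      have : ¬ ∀ k ∈ Lo, k < j → aff k x < lo x := fun h => hxn ⟨hxD, hxj, h⟩
      push Not at this
      obtain ⟨k, hkLo, hkj, hk⟩ := this
      have hle : aff k x ≤ lo x :=
        Finset.le_sup' (fun k => (b k - (α k * x.1 + β k * x.2)) / c k) hkLo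
      have hEq : aff j x = aff k x := by rw [hxj]; exact le_antisymm hk hle
      refine Set.mem_biUnion (Finset.mem_filter.2 ⟨hkLo, hkj⟩) ?_
      simp only [Set.mem_setOf_eq]
      have e1 : (b j - α j * x.1 - β j * x.2) / c j = aff j x := by rw [haff]; ring_nf
      have e2 : (b k - α k * x.1 - β k * x.2) / c k = aff k x := by rw [haff]; ring_nf
      rw [e1, e2]; exact hEq
    refine measure_mono_null hcover ?_
    refine (measure_biUnion_null_iff (Lo.filter (fun k => k < j)).countable_toSet).2 fun k hk => ?_
    have hk' := Finset.mem_filter.1 hk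
    have hkLo := Finset.mem_filter.1 hk'.1
    exact volume_tieSet_eq_zero hcj.ne hkLo.2.ne (hnd k hkLo.1 (ne_of_lt hk'.2) hkLo.2)
  have hae : Dj =ᵐ[volume] Sj := by
    refine (ae_eq_set).2 ⟨?_, hnull⟩
    exact measure_mono_null (fun x hx => (hx.2 (hsub1 hx.1)).elim) measure_empty
  -- (ii) graph integral over `Sj` by the facet chart
  have hL4 := setIntegral_graph_eq_mul_integral_chart (α := α j) (β := β j) (c := c j) (b := b j)
    hcj.ne p₀ u v hp₀ hnu hnv hu hv huv hSjm g
  -- (iii) on the chart, `1_{Sj} ∘ π = 1_P`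
  have hPeq := setOf_hConstraints_eq_between_graphs (J := J)
    (fun k (x : ℝ × ℝ) => α k * x.1 + β k * x.2) c b hup hlow
  have hplane : ∀ y : ℝ × ℝ, (p₀ + y.1 • u + y.2 • v).2 = aff j (p₀ + y.1 • u + y.2 • v).1 := by
    intro y
    simp only [haff, Prod.fst_add, Prod.snd_add, Prod.smul_fst, Prod.smul_snd, smul_eq_mul]
    rw [eq_div_iff hcj.ne]
    linear_combination hp₀ + y.1 * hnu + y.2 * hnv
  have hind : ∀ y : ℝ × ℝ, Sj.indicator (fun _ => (1 : ℝ)) (p₀ + y.1 • u + y.2 • v).1 =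
      P.indicator (fun _ => (1 : ℝ)) (p₀ + y.1 • u + y.2 • v) := by
    intro y
    have hiff : (p₀ + y.1 • u + y.2 • v).1 ∈ Sj ↔ (p₀ + y.1 • u + y.2 • v) ∈ P := by
      have hmemP : (p₀ + y.1 • u + y.2 • v) ∈ P ↔ (p₀ + y.1 • u + y.2 • v).1 ∈ D ∧
          lo (p₀ + y.1 • u + y.2 • v).1 ≤ (p₀ + y.1 • u + y.2 • v).2 ∧
          (p₀ + y.1 • u + y.2 • v).2 ≤ hi (p₀ + y.1 • u + y.2 • v).1 := by
        rw [hP]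
        change (p₀ + y.1 • u + y.2 • v) ∈
          {p : (ℝ × ℝ) × ℝ | ∀ k ∈ J, (fun k (x : ℝ × ℝ) => α k * x.1 + β k * x.2) k p.1 + c k * p.2 ≤ b k}
          ↔ _
        rw [hPeq]
        rfl
      rw [hmemP, hplane]
      set x := (p₀ + y.1 • u + y.2 • v).1
      have hle : aff j x ≤ lo x := Finset.le_sup' (fun k => (b k - (α k * x.1 + β k * x.2)) / c k) hjLo
      constructor
      · rintro ⟨hxD, hxj⟩
        exact ⟨hxD, le_of_eq hxj.symm, by rw [hxj]; exact hxD.2⟩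
      · rintro ⟨hxD, hge, -⟩
        exact ⟨hxD, le_antisymm hle hge⟩
    by_cases hm : (p₀ + y.1 • u + y.2 • v).1 ∈ Sj
    · rw [Set.indicator_of_mem hm, Set.indicator_of_mem (hiff.1 hm)]
    · rw [Set.indicator_of_notMem hm, Set.indicator_of_notMem (fun h => hm (hiff.2 h))]
  -- assemble
  have e0 : (fun x : ℝ × ℝ => g (x, (b j - (α j * x.1 + β j * x.2)) / c j)) =
      fun x => g (x, (b j - α j * x.1 - β j * x.2) / c j) := by
    funext x; ring_nf
  calc ∫ x in Dj, g (x, (b j - (α j * x.1 + β j * x.2)) / c j)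
      = ∫ x in Sj, g (x, (b j - (α j * x.1 + β j * x.2)) / c j) := setIntegral_congr_set hae
    _ = ∫ x in Sj, g (x, (b j - α j * x.1 - β j * x.2) / c j) := by rw [e0]
    _ = |c j| / Real.sqrt (α j ^ 2 + β j ^ 2 + c j ^ 2) *
          ∫ y : ℝ × ℝ, Sj.indicator (fun _ => (1 : ℝ)) (p₀ + y.1 • u + y.2 • v).1 *
            g (p₀ + y.1 • u + y.2 • v) := hL4
    _ = -c j / Real.sqrt (α j ^ 2 + β j ^ 2 + c j ^ 2) *
          ∫ y : ℝ × ℝ, P.indicator (fun _ => (1 : ℝ)) (p₀ + y.1 • u + y.2 • v) *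
            g (p₀ + y.1 • u + y.2 • v) := by
        rw [abs_of_neg hcj]
        congr 1
        refine integral_congr_ae (Filter.Eventually.of_forall fun y => ?_)
        beta_reduce
        rw [hind y]

end Literature.MeasureTheory.Integral

end
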